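import Literature.AlgebraicGeometry.Deformation.CanonicalRestrictedLiftQuot
import HarnessLib

/-!
# Canonical restricted lifts, II: gluings restrict canonically ([Hartshorne2010] proof of Thm. 10.2 (a) «`φ_{ij}|_{U_{ijk}}`»; [Oort1971] Lemma (2.2.4))

Layer `Literature/AlgebraicGeometry/Deformation`, namespace `Literature.AlgebraicGeometry.Deformation.CanonicalLiftQuot` (continued).
DEFINITION FILE (two constructions `gluingRestrictHom`, `gluingRestrict` + their API; no instance, no notation, no named fact, no `sorry`).
Quotient-currency (U) organ (cell `hodgecm-mathlib`, P6 sub-desk P6b; count-neutral), sequel of ★∕GREEN `CanonicalRestrictedLiftQuot` (U-can).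

THE PRINT.  [Hartshorne2010, proof of Thm. 10.2 (a), p. 81]: «choose isomorphisms `φ_{ij} : U'_i|_{U_{ij}} ⥲ U'_j|_{U_{ij}}` … on `U_{ijk}` the
composition `φ_{ik}^{-1} φ_{jk} φ_{ij}|_{U_{ijk}}`» — the RESTRICTION of a gluing to a deeper overlap.  With the canonical restricted lifts
`L(r, g)` of (U-can) this restriction is CHOICE-FREE: a reduction-compatible gluing `ψ : L(r₁, g₁) ≃ₐ[A'] L(r₂, g₂)` of two charts over an
overlap ring `O` extends UNIQUELY along the canonical restrictions to `ψ′ : L(r₁, g₁′) ≃ₐ[A'] L(r₂, g₂′)` over any deeper ring `O′`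
(`gᵢ′ = k ∘ gᵢ`), because `L(r₁, g₁′)` is the localisation of `L(r₁, g₁)` at the image of `liftSubmonoid r₁ g₁′` (Mathlib
`isLocalization_of_submonoid_le`) and those elements go to units under `restrict ∘ ψ` (their reductions are units on `O′`; units lift modulo the
nilpotent `J`).  No `IsLocalization.Away`-over-`S` hypothesis and no chosen equation enter the construction; the EXISTENCE of an equation of the deeper
open (`∃ q₂′, O′ = Q₂[1/q₂′]`) is used only to know that the reduction of `L(r₂, g₂′)` is onto with nilpotent kernel.

* §1 `isLocalization_map_restrict`, `algHom_ext_restrict`, `isUnit_restrict_gluing`, `gluingRestrictHom` (one direction, `IsLocalization.liftAlgHom`), intertwining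
  `gluingRestrictHom_restrict`, uniqueness `gluingRestrictHom_unique`, reduction-compatibility `reduction_gluingRestrictHom`.
* §2 `gluingRestrict` — the two-sided version `L(r₁, g₁′) ≃ₐ[A'] L(r₂, g₂′)` (`AlgEquiv.ofAlgHom` of the two one-directional maps, inverse to
  each other by uniqueness), with `gluingRestrict_apply`, `gluingRestrict_restrict`, `gluingRestrict_symm_restrict`, `reduction_gluingRestrict`,
  `gluingRestrict_unique`.

HC_CM is proved only modulo the printed citations until rung 0 closes; nothing here bears on a summit statement.

## References
* [Hartshorne2010] R. Hartshorne, *Deformation Theory*, GTM 257, Springer (2010): Thm. 10.2 (a) and its proof (p. 81).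
* [Oort1971] F. Oort, *Finite group schemes, local moduli for abelian varieties, and lifting problems*, Compositio Math. 23 (1971),
  Lemma (2.2.4) (p. 274).
* [StacksProject] The Stacks Project, Tag 00CP (localisation of localisations).
-/

noncomputable section

universe u

namespace Literature.AlgebraicGeometry.Deformation.CanonicalLiftQuot

open Literature.AlgebraicGeometry.Deformation.LiftLocalizationQuot Literature.AlgebraicGeometry.Deformation.LiftGluingSuppliersQuot

variable {A' : Type u} [CommRing A'] {P : Type u} [CommRing P] [Algebra A' P] {Q : Type u} [CommRing Q] [Algebra A' Q]
  {Q' : Type u} [CommRing Q'] {Q'' : Type u} [CommRing Q'']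

/-! ## §1 The one-directional restricted gluing -/

section Gluing

variable {P₁ : Type u} [CommRing P₁] [Algebra A' P₁] {P₂ : Type u} [CommRing P₂] [Algebra A' P₂]
  {Q₁ : Type u} [CommRing Q₁] [Algebra A' Q₁] {Q₂ : Type u} [CommRing Q₂] [Algebra A' Q₂]
  {O : Type u} [CommRing O] [Algebra A' O] {O' : Type u} [CommRing O'] [Algebra A' O']

/-- The `S`-algebra structure `restrict : L(r, g) → L(r, g″)` makes `L(r, g″)` the localisation of `L(r, g)` at the image of `liftSubmonoid r g″`
(Mathlib `isLocalization_of_submonoid_le`). [cite: StacksProject, Tag 00CP] -/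
theorem isLocalization_map_restrict (r : P →ₐ[A'] Q) (g : Q →+* Q') (g'' : Q →+* Q'') (hle : liftSubmonoid r g ≤ liftSubmonoid r g'') :
    @IsLocalization _ _ ((liftSubmonoid r g'').map (algebraMap P (CanonicalLift r g))) (CanonicalLift r g'') _
      (restrict r g g'' hle).toRingHom.toAlgebra := by
  letI := (restrict r g g'' hle).toRingHom.toAlgebra
  haveI : IsScalarTower P (CanonicalLift r g) (CanonicalLift r g'') :=
    IsScalarTower.of_algebraMap_eq fun p => (restrict_algebraMap r g g'' hle p).symm
  exact IsLocalization.isLocalization_of_submonoid_le (CanonicalLift r g) (CanonicalLift r g'') _ _ hle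

/-- **Extensionality out of a deeper lift:** two algebra maps `L(r, g″) → C` that agree after the canonical restriction from `L(r, g)` are equal
(`L(r, g″)` is a localisation of `L(r, g)`). [cite: StacksProject, Tag 00CP] -/
theorem algHom_ext_restrict (r : P →ₐ[A'] Q) (g : Q →+* Q') (g'' : Q →+* Q'') (hle : liftSubmonoid r g ≤ liftSubmonoid r g'')
    {C : Type*} [CommRing C] [Algebra A' C] (φ χ : CanonicalLift r g'' →ₐ[A'] C)
    (h : ∀ x, φ (restrict r g g'' hle x) = χ (restrict r g g'' hle x)) : φ = χ := by
  letI := (restrict r g g'' hle).toRingHom.toAlgebra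
  haveI := isLocalization_map_restrict r g g'' hle
  exact algHom_ext_of_isLocalization ((liftSubmonoid r g'').map (algebraMap P (CanonicalLift r g))) φ χ h

/-- **Units for the restricted gluing:** under a reduction-compatible gluing `ψ : L(r₁, g₁) ≃ L(r₂, g₂)`, an element of `P₁` invertible on the
deeper open goes to a unit of `L(r₂, g₂′)` (its reduction is a unit; units lift modulo the nilpotent `J`).
[cite: Hartshorne2010, Thm. 10.2 (a) (proof), p. 81] -/
theorem isUnit_restrict_gluing {J : Ideal A'} (hJ : IsNilpotent J) (r₁ : P₁ →ₐ[A'] Q₁)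
    (r₂ : P₂ →ₐ[A'] Q₂) (hr₂ : Function.Surjective r₂) (hkr₂ : RingHom.ker r₂ = J.map (algebraMap A' P₂))
    (g₁ : Q₁ →+* O) (hg₁ : ∀ a, g₁ (algebraMap A' Q₁ a) = algebraMap A' O a)
    (g₂ : Q₂ →+* O) (hg₂ : ∀ a, g₂ (algebraMap A' Q₂ a) = algebraMap A' O a)
    (g₁' : Q₁ →+* O') (g₂' : Q₂ →+* O') (hg₂' : ∀ a, g₂' (algebraMap A' Q₂ a) = algebraMap A' O' a)
    (k : O →+* O') (hk₁ : ∀ q, g₁' q = k (g₁ q)) (hk₂ : ∀ q, g₂' q = k (g₂ q))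
    (hO'₂ : ∃ q : Q₂, @IsLocalization.Away Q₂ _ q O' _ g₂'.toAlgebra)
    (ψ : CanonicalLift r₁ g₁ ≃ₐ[A'] CanonicalLift r₂ g₂) (hψ : ∀ x, reduction r₂ g₂ hg₂ (ψ x) = reduction r₁ g₁ hg₁ x)
    (m : P₁) (hm : m ∈ liftSubmonoid r₁ g₁') :
    IsUnit (restrict r₂ g₂ g₂' (liftSubmonoid_mono r₂ g₂ g₂' k hk₂) (ψ (algebraMap P₁ (CanonicalLift r₁ g₁) m))) := by
  obtain ⟨q₂', hO'₂⟩ := hO'₂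
  refine isUnit_of_isUnit_map (reduction r₂ g₂' hg₂' : CanonicalLift r₂ g₂' →+* O')
    (reduction_surjective hJ r₂ hr₂ hkr₂ g₂' hg₂' hO'₂) ?_ ?_
  · rw [show RingHom.ker (reduction r₂ g₂' hg₂' : CanonicalLift r₂ g₂' →+* O') = J.map (algebraMap A' (CanonicalLift r₂ g₂')) from
      ker_reduction hJ r₂ hr₂ hkr₂ g₂' hg₂' hO'₂]
    exact isNilpotent_map_of_isNilpotent hJ
  · rw [RingHom.coe_coe, reduction_restrict r₂ g₂ hg₂ g₂' hg₂' k hk₂, hψ, reduction_algebraMap, ← hk₁]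
    exact (mem_liftSubmonoid_iff r₁ g₁' m).mp hm

/-- The one-directional restricted gluing as an algebra map (`IsLocalization.liftAlgHom` over the image submonoid).
[cite: Hartshorne2010, Thm. 10.2 (a) (proof), p. 81] [cite: StacksProject, Tag 00CP] -/
def gluingRestrictHom {J : Ideal A'} (hJ : IsNilpotent J) (r₁ : P₁ →ₐ[A'] Q₁)
    (r₂ : P₂ →ₐ[A'] Q₂) (hr₂ : Function.Surjective r₂) (hkr₂ : RingHom.ker r₂ = J.map (algebraMap A' P₂))
    (g₁ : Q₁ →+* O) (hg₁ : ∀ a, g₁ (algebraMap A' Q₁ a) = algebraMap A' O a)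
    (g₂ : Q₂ →+* O) (hg₂ : ∀ a, g₂ (algebraMap A' Q₂ a) = algebraMap A' O a)
    (g₁' : Q₁ →+* O') (g₂' : Q₂ →+* O') (hg₂' : ∀ a, g₂' (algebraMap A' Q₂ a) = algebraMap A' O' a)
    (k : O →+* O') (hk₁ : ∀ q, g₁' q = k (g₁ q)) (hk₂ : ∀ q, g₂' q = k (g₂ q))
    (hO'₂ : ∃ q : Q₂, @IsLocalization.Away Q₂ _ q O' _ g₂'.toAlgebra)
    (ψ : CanonicalLift r₁ g₁ ≃ₐ[A'] CanonicalLift r₂ g₂) (hψ : ∀ x, reduction r₂ g₂ hg₂ (ψ x) = reduction r₁ g₁ hg₁ x) :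
    CanonicalLift r₁ g₁' →ₐ[A'] CanonicalLift r₂ g₂' :=
  letI := (restrict r₁ g₁ g₁' (liftSubmonoid_mono r₁ g₁ g₁' k hk₁)).toRingHom.toAlgebra
  haveI : IsScalarTower A' (CanonicalLift r₁ g₁) (CanonicalLift r₁ g₁') :=
    IsScalarTower.of_algebraMap_eq fun a => ((restrict r₁ g₁ g₁' (liftSubmonoid_mono r₁ g₁ g₁' k hk₁)).commutes a).symm
  haveI := isLocalization_map_restrict r₁ g₁ g₁' (liftSubmonoid_mono r₁ g₁ g₁' k hk₁)
  IsLocalization.liftAlgHom (M := (liftSubmonoid r₁ g₁').map (algebraMap P₁ (CanonicalLift r₁ g₁)))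
    (f := (restrict r₂ g₂ g₂' (liftSubmonoid_mono r₂ g₂ g₂' k hk₂)).comp (ψ : CanonicalLift r₁ g₁ →ₐ[A'] CanonicalLift r₂ g₂))
    fun y => by
      obtain ⟨m, hm, hy⟩ := (Submonoid.mem_map).mp y.2
      rw [← hy]
      exact isUnit_restrict_gluing hJ r₁ r₂ hr₂ hkr₂ g₁ hg₁ g₂ hg₂ g₁' g₂' hg₂' k hk₁ hk₂ hO'₂ ψ hψ m hm

/-- The restricted gluing INTERTWINES the canonical restrictions: `ψ′ (x|) = (ψ x)|`. [cite: Hartshorne2010, Thm. 10.2 (a) (proof), p. 81] -/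
theorem gluingRestrictHom_restrict {J : Ideal A'} (hJ : IsNilpotent J) (r₁ : P₁ →ₐ[A'] Q₁)
    (r₂ : P₂ →ₐ[A'] Q₂) (hr₂ : Function.Surjective r₂) (hkr₂ : RingHom.ker r₂ = J.map (algebraMap A' P₂))
    (g₁ : Q₁ →+* O) (hg₁ : ∀ a, g₁ (algebraMap A' Q₁ a) = algebraMap A' O a)
    (g₂ : Q₂ →+* O) (hg₂ : ∀ a, g₂ (algebraMap A' Q₂ a) = algebraMap A' O a)
    (g₁' : Q₁ →+* O') (g₂' : Q₂ →+* O') (hg₂' : ∀ a, g₂' (algebraMap A' Q₂ a) = algebraMap A' O' a)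
    (k : O →+* O') (hk₁ : ∀ q, g₁' q = k (g₁ q)) (hk₂ : ∀ q, g₂' q = k (g₂ q))
    (hO'₂ : ∃ q : Q₂, @IsLocalization.Away Q₂ _ q O' _ g₂'.toAlgebra)
    (ψ : CanonicalLift r₁ g₁ ≃ₐ[A'] CanonicalLift r₂ g₂) (hψ : ∀ x, reduction r₂ g₂ hg₂ (ψ x) = reduction r₁ g₁ hg₁ x)
    (x : CanonicalLift r₁ g₁) :
    gluingRestrictHom hJ r₁ r₂ hr₂ hkr₂ g₁ hg₁ g₂ hg₂ g₁' g₂' hg₂' k hk₁ hk₂ hO'₂ ψ hψ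
        (restrict r₁ g₁ g₁' (liftSubmonoid_mono r₁ g₁ g₁' k hk₁) x) =
      restrict r₂ g₂ g₂' (liftSubmonoid_mono r₂ g₂ g₂' k hk₂) (ψ x) := by
  letI := (restrict r₁ g₁ g₁' (liftSubmonoid_mono r₁ g₁ g₁' k hk₁)).toRingHom.toAlgebra
  haveI : IsScalarTower A' (CanonicalLift r₁ g₁) (CanonicalLift r₁ g₁') :=
    IsScalarTower.of_algebraMap_eq fun a => ((restrict r₁ g₁ g₁' (liftSubmonoid_mono r₁ g₁ g₁' k hk₁)).commutes a).symm
  haveI := isLocalization_map_restrict r₁ g₁ g₁' (liftSubmonoid_mono r₁ g₁ g₁' k hk₁)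
  rw [gluingRestrictHom, IsLocalization.liftAlgHom_apply]
  exact IsLocalization.lift_eq _ x

/-- **Uniqueness of the restricted gluing:** an algebra map `L(r₁, g₁′) → L(r₂, g₂′)` intertwining the restrictions with `ψ` IS
`gluingRestrictHom`. [cite: Hartshorne2010, Thm. 10.2 (a) (proof), p. 81] [cite: StacksProject, Tag 00CP] -/
theorem gluingRestrictHom_unique {J : Ideal A'} (hJ : IsNilpotent J) (r₁ : P₁ →ₐ[A'] Q₁)
    (r₂ : P₂ →ₐ[A'] Q₂) (hr₂ : Function.Surjective r₂) (hkr₂ : RingHom.ker r₂ = J.map (algebraMap A' P₂))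
    (g₁ : Q₁ →+* O) (hg₁ : ∀ a, g₁ (algebraMap A' Q₁ a) = algebraMap A' O a)
    (g₂ : Q₂ →+* O) (hg₂ : ∀ a, g₂ (algebraMap A' Q₂ a) = algebraMap A' O a)
    (g₁' : Q₁ →+* O') (g₂' : Q₂ →+* O') (hg₂' : ∀ a, g₂' (algebraMap A' Q₂ a) = algebraMap A' O' a)
    (k : O →+* O') (hk₁ : ∀ q, g₁' q = k (g₁ q)) (hk₂ : ∀ q, g₂' q = k (g₂ q))
    (hO'₂ : ∃ q : Q₂, @IsLocalization.Away Q₂ _ q O' _ g₂'.toAlgebra)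
    (ψ : CanonicalLift r₁ g₁ ≃ₐ[A'] CanonicalLift r₂ g₂) (hψ : ∀ x, reduction r₂ g₂ hg₂ (ψ x) = reduction r₁ g₁ hg₁ x)
    (φ : CanonicalLift r₁ g₁' →ₐ[A'] CanonicalLift r₂ g₂')
    (hφ : ∀ x, φ (restrict r₁ g₁ g₁' (liftSubmonoid_mono r₁ g₁ g₁' k hk₁) x) =
      restrict r₂ g₂ g₂' (liftSubmonoid_mono r₂ g₂ g₂' k hk₂) (ψ x)) :
    φ = gluingRestrictHom hJ r₁ r₂ hr₂ hkr₂ g₁ hg₁ g₂ hg₂ g₁' g₂' hg₂' k hk₁ hk₂ hO'₂ ψ hψ := by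
  letI := (restrict r₁ g₁ g₁' (liftSubmonoid_mono r₁ g₁ g₁' k hk₁)).toRingHom.toAlgebra
  haveI : IsScalarTower A' (CanonicalLift r₁ g₁) (CanonicalLift r₁ g₁') :=
    IsScalarTower.of_algebraMap_eq fun a => ((restrict r₁ g₁ g₁' (liftSubmonoid_mono r₁ g₁ g₁' k hk₁)).commutes a).symm
  haveI := isLocalization_map_restrict r₁ g₁ g₁' (liftSubmonoid_mono r₁ g₁ g₁' k hk₁)
  exact algHom_ext_of_isLocalization ((liftSubmonoid r₁ g₁').map (algebraMap P₁ (CanonicalLift r₁ g₁))) φ _ fun x => by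
    rw [show algebraMap (CanonicalLift r₁ g₁) (CanonicalLift r₁ g₁') x =
        restrict r₁ g₁ g₁' (liftSubmonoid_mono r₁ g₁ g₁' k hk₁) x from rfl, hφ,
      gluingRestrictHom_restrict]

/-- The restricted gluing is REDUCTION-COMPATIBLE on the deeper open. [cite: Hartshorne2010, Thm. 10.2 (a) (proof), p. 81] -/
theorem reduction_gluingRestrictHom {J : Ideal A'} (hJ : IsNilpotent J) (r₁ : P₁ →ₐ[A'] Q₁)
    (r₂ : P₂ →ₐ[A'] Q₂) (hr₂ : Function.Surjective r₂) (hkr₂ : RingHom.ker r₂ = J.map (algebraMap A' P₂))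
    (g₁ : Q₁ →+* O) (hg₁ : ∀ a, g₁ (algebraMap A' Q₁ a) = algebraMap A' O a)
    (g₂ : Q₂ →+* O) (hg₂ : ∀ a, g₂ (algebraMap A' Q₂ a) = algebraMap A' O a)
    (g₁' : Q₁ →+* O') (hg₁' : ∀ a, g₁' (algebraMap A' Q₁ a) = algebraMap A' O' a)
    (g₂' : Q₂ →+* O') (hg₂' : ∀ a, g₂' (algebraMap A' Q₂ a) = algebraMap A' O' a)
    (k : O →+* O') (hk₁ : ∀ q, g₁' q = k (g₁ q)) (hk₂ : ∀ q, g₂' q = k (g₂ q))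
    (hO'₂ : ∃ q : Q₂, @IsLocalization.Away Q₂ _ q O' _ g₂'.toAlgebra)
    (ψ : CanonicalLift r₁ g₁ ≃ₐ[A'] CanonicalLift r₂ g₂) (hψ : ∀ x, reduction r₂ g₂ hg₂ (ψ x) = reduction r₁ g₁ hg₁ x)
    (y : CanonicalLift r₁ g₁') :
    reduction r₂ g₂' hg₂' (gluingRestrictHom hJ r₁ r₂ hr₂ hkr₂ g₁ hg₁ g₂ hg₂ g₁' g₂' hg₂' k hk₁ hk₂ hO'₂ ψ hψ y) =
      reduction r₁ g₁' hg₁' y := by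
  letI := (restrict r₁ g₁ g₁' (liftSubmonoid_mono r₁ g₁ g₁' k hk₁)).toRingHom.toAlgebra
  haveI : IsScalarTower A' (CanonicalLift r₁ g₁) (CanonicalLift r₁ g₁') :=
    IsScalarTower.of_algebraMap_eq fun a => ((restrict r₁ g₁ g₁' (liftSubmonoid_mono r₁ g₁ g₁' k hk₁)).commutes a).symm
  haveI := isLocalization_map_restrict r₁ g₁ g₁' (liftSubmonoid_mono r₁ g₁ g₁' k hk₁)
  have key : (reduction r₂ g₂' hg₂').comp
      (gluingRestrictHom hJ r₁ r₂ hr₂ hkr₂ g₁ hg₁ g₂ hg₂ g₁' g₂' hg₂' k hk₁ hk₂ hO'₂ ψ hψ) = reduction r₁ g₁' hg₁' :=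
    algHom_ext_of_isLocalization ((liftSubmonoid r₁ g₁').map (algebraMap P₁ (CanonicalLift r₁ g₁))) _ _ fun x => by
      rw [show algebraMap (CanonicalLift r₁ g₁) (CanonicalLift r₁ g₁') x =
          restrict r₁ g₁ g₁' (liftSubmonoid_mono r₁ g₁ g₁' k hk₁) x from rfl, AlgHom.comp_apply,
        gluingRestrictHom_restrict, reduction_restrict r₂ g₂ hg₂ g₂' hg₂' k hk₂, hψ,
        reduction_restrict r₁ g₁ hg₁ g₁' hg₁' k hk₁]
  exact congrArg (fun f => f y) key

/-! ## §2 The two-sided restricted gluing -/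

/-- Reduction-compatibility passes to the inverse gluing. [cite: Hartshorne2010, Thm. 10.2 (a) (proof), p. 81] -/
theorem reduction_symm (r₁ : P₁ →ₐ[A'] Q₁) (r₂ : P₂ →ₐ[A'] Q₂)
    (g₁ : Q₁ →+* O) (hg₁ : ∀ a, g₁ (algebraMap A' Q₁ a) = algebraMap A' O a)
    (g₂ : Q₂ →+* O) (hg₂ : ∀ a, g₂ (algebraMap A' Q₂ a) = algebraMap A' O a)
    (ψ : CanonicalLift r₁ g₁ ≃ₐ[A'] CanonicalLift r₂ g₂) (hψ : ∀ x, reduction r₂ g₂ hg₂ (ψ x) = reduction r₁ g₁ hg₁ x)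
    (y : CanonicalLift r₂ g₂) : reduction r₁ g₁ hg₁ (ψ.symm y) = reduction r₂ g₂ hg₂ y :=
  compat_symm (reduction r₁ g₁ hg₁) (reduction r₂ g₂ hg₂) ψ hψ y

/-- **THE RESTRICTED GLUING** `ψ′ : L(r₁, g₁′) ≃ₐ[A'] L(r₂, g₂′)` of a reduction-compatible gluing `ψ : L(r₁, g₁) ≃ₐ[A'] L(r₂, g₂)` to a
deeper overlap — the two one-directional restricted gluings (of `ψ` and of `ψ⁻¹`) are mutually inverse by uniqueness.  Needs the deeper open to be
principal on both charts (`∃ qᵢ′, O′ = Qᵢ[1/qᵢ′]` — a `Prop`, so the construction does not depend on a chosen equation) (only to know the reductions there are onto with nilpotent kernel).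
[cite: Hartshorne2010, Thm. 10.2 (a) (proof), p. 81] [cite: Oort1971, Lemma (2.2.4) (p. 274)] -/
def gluingRestrict {J : Ideal A'} (hJ : IsNilpotent J)
    (r₁ : P₁ →ₐ[A'] Q₁) (hr₁ : Function.Surjective r₁) (hkr₁ : RingHom.ker r₁ = J.map (algebraMap A' P₁))
    (r₂ : P₂ →ₐ[A'] Q₂) (hr₂ : Function.Surjective r₂) (hkr₂ : RingHom.ker r₂ = J.map (algebraMap A' P₂))
    (g₁ : Q₁ →+* O) (hg₁ : ∀ a, g₁ (algebraMap A' Q₁ a) = algebraMap A' O a)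
    (g₂ : Q₂ →+* O) (hg₂ : ∀ a, g₂ (algebraMap A' Q₂ a) = algebraMap A' O a)
    (g₁' : Q₁ →+* O') (hg₁' : ∀ a, g₁' (algebraMap A' Q₁ a) = algebraMap A' O' a)
    (g₂' : Q₂ →+* O') (hg₂' : ∀ a, g₂' (algebraMap A' Q₂ a) = algebraMap A' O' a)
    (k : O →+* O') (hk₁ : ∀ q, g₁' q = k (g₁ q)) (hk₂ : ∀ q, g₂' q = k (g₂ q))
    (hO'₁ : ∃ q : Q₁, @IsLocalization.Away Q₁ _ q O' _ g₁'.toAlgebra)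
    (hO'₂ : ∃ q : Q₂, @IsLocalization.Away Q₂ _ q O' _ g₂'.toAlgebra)
    (ψ : CanonicalLift r₁ g₁ ≃ₐ[A'] CanonicalLift r₂ g₂) (hψ : ∀ x, reduction r₂ g₂ hg₂ (ψ x) = reduction r₁ g₁ hg₁ x) :
    CanonicalLift r₁ g₁' ≃ₐ[A'] CanonicalLift r₂ g₂' :=
  AlgEquiv.ofAlgHom (gluingRestrictHom hJ r₁ r₂ hr₂ hkr₂ g₁ hg₁ g₂ hg₂ g₁' g₂' hg₂' k hk₁ hk₂ hO'₂ ψ hψ)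
    (gluingRestrictHom hJ r₂ r₁ hr₁ hkr₁ g₂ hg₂ g₁ hg₁ g₂' g₁' hg₁' k hk₂ hk₁ hO'₁ ψ.symm
      (reduction_symm r₁ r₂ g₁ hg₁ g₂ hg₂ ψ hψ))
    (by
      have h1 := gluingRestrictHom_unique hJ r₂ r₂ hr₂ hkr₂ g₂ hg₂ g₂ hg₂ g₂' g₂' hg₂' k hk₂ hk₂ hO'₂ AlgEquiv.refl
        (fun _ => rfl)
        ((gluingRestrictHom hJ r₁ r₂ hr₂ hkr₂ g₁ hg₁ g₂ hg₂ g₁' g₂' hg₂' k hk₁ hk₂ hO'₂ ψ hψ).comp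
          (gluingRestrictHom hJ r₂ r₁ hr₁ hkr₁ g₂ hg₂ g₁ hg₁ g₂' g₁' hg₁' k hk₂ hk₁ hO'₁ ψ.symm
            (reduction_symm r₁ r₂ g₁ hg₁ g₂ hg₂ ψ hψ)))
        fun x => by
          simp only [AlgHom.comp_apply, gluingRestrictHom_restrict, AlgEquiv.apply_symm_apply, AlgEquiv.coe_refl, id_eq]
      have h2 := gluingRestrictHom_unique hJ r₂ r₂ hr₂ hkr₂ g₂ hg₂ g₂ hg₂ g₂' g₂' hg₂' k hk₂ hk₂ hO'₂ AlgEquiv.refl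
        (fun _ => rfl) (AlgHom.id A' _) fun x => by simp only [AlgHom.id_apply, AlgEquiv.coe_refl, id_eq]
      exact h1.trans h2.symm)
    (by
      have h1 := gluingRestrictHom_unique hJ r₁ r₁ hr₁ hkr₁ g₁ hg₁ g₁ hg₁ g₁' g₁' hg₁' k hk₁ hk₁ hO'₁ AlgEquiv.refl
        (fun _ => rfl)
        ((gluingRestrictHom hJ r₂ r₁ hr₁ hkr₁ g₂ hg₂ g₁ hg₁ g₂' g₁' hg₁' k hk₂ hk₁ hO'₁ ψ.symm
            (reduction_symm r₁ r₂ g₁ hg₁ g₂ hg₂ ψ hψ)).comp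
          (gluingRestrictHom hJ r₁ r₂ hr₂ hkr₂ g₁ hg₁ g₂ hg₂ g₁' g₂' hg₂' k hk₁ hk₂ hO'₂ ψ hψ))
        fun x => by
          simp only [AlgHom.comp_apply, gluingRestrictHom_restrict, AlgEquiv.symm_apply_apply, AlgEquiv.coe_refl, id_eq]
      have h2 := gluingRestrictHom_unique hJ r₁ r₁ hr₁ hkr₁ g₁ hg₁ g₁ hg₁ g₁' g₁' hg₁' k hk₁ hk₁ hO'₁ AlgEquiv.refl
        (fun _ => rfl) (AlgHom.id A' _) fun x => by simp only [AlgHom.id_apply, AlgEquiv.coe_refl, id_eq]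
      exact h1.trans h2.symm)

section Equiv

variable {J : Ideal A'} (hJ : IsNilpotent J)
    (r₁ : P₁ →ₐ[A'] Q₁) (hr₁ : Function.Surjective r₁) (hkr₁ : RingHom.ker r₁ = J.map (algebraMap A' P₁))
    (r₂ : P₂ →ₐ[A'] Q₂) (hr₂ : Function.Surjective r₂) (hkr₂ : RingHom.ker r₂ = J.map (algebraMap A' P₂))
    (g₁ : Q₁ →+* O) (hg₁ : ∀ a, g₁ (algebraMap A' Q₁ a) = algebraMap A' O a)
    (g₂ : Q₂ →+* O) (hg₂ : ∀ a, g₂ (algebraMap A' Q₂ a) = algebraMap A' O a)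
    (g₁' : Q₁ →+* O') (hg₁' : ∀ a, g₁' (algebraMap A' Q₁ a) = algebraMap A' O' a)
    (g₂' : Q₂ →+* O') (hg₂' : ∀ a, g₂' (algebraMap A' Q₂ a) = algebraMap A' O' a)
    (k : O →+* O') (hk₁ : ∀ q, g₁' q = k (g₁ q)) (hk₂ : ∀ q, g₂' q = k (g₂ q))
    (hO'₁ : ∃ q : Q₁, @IsLocalization.Away Q₁ _ q O' _ g₁'.toAlgebra)
    (hO'₂ : ∃ q : Q₂, @IsLocalization.Away Q₂ _ q O' _ g₂'.toAlgebra)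
    (ψ : CanonicalLift r₁ g₁ ≃ₐ[A'] CanonicalLift r₂ g₂) (hψ : ∀ x, reduction r₂ g₂ hg₂ (ψ x) = reduction r₁ g₁ hg₁ x)

/-- `gluingRestrict` acts as the one-directional `gluingRestrictHom`. [cite: Hartshorne2010, Thm. 10.2 (a) (proof), p. 81] -/
theorem gluingRestrict_apply (y : CanonicalLift r₁ g₁') :
    gluingRestrict hJ r₁ hr₁ hkr₁ r₂ hr₂ hkr₂ g₁ hg₁ g₂ hg₂ g₁' hg₁' g₂' hg₂' k hk₁ hk₂ hO'₁ hO'₂ ψ hψ y =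
      gluingRestrictHom hJ r₁ r₂ hr₂ hkr₂ g₁ hg₁ g₂ hg₂ g₁' g₂' hg₂' k hk₁ hk₂ hO'₂ ψ hψ y :=
  rfl

/-- `gluingRestrict⁻¹` acts as the one-directional restricted gluing of `ψ⁻¹`. [cite: Hartshorne2010, Thm. 10.2 (a) (proof), p. 81] -/
theorem gluingRestrict_symm_apply (z : CanonicalLift r₂ g₂') :
    (gluingRestrict hJ r₁ hr₁ hkr₁ r₂ hr₂ hkr₂ g₁ hg₁ g₂ hg₂ g₁' hg₁' g₂' hg₂' k hk₁ hk₂ hO'₁ hO'₂ ψ hψ).symm z =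
      gluingRestrictHom hJ r₂ r₁ hr₁ hkr₁ g₂ hg₂ g₁ hg₁ g₂' g₁' hg₁' k hk₂ hk₁ hO'₁ ψ.symm
        (reduction_symm r₁ r₂ g₁ hg₁ g₂ hg₂ ψ hψ) z :=
  rfl

/-- **Intertwining:** `ψ′ (x|) = (ψ x)|`. [cite: Hartshorne2010, Thm. 10.2 (a) (proof), p. 81] -/
theorem gluingRestrict_restrict (x : CanonicalLift r₁ g₁) :
    gluingRestrict hJ r₁ hr₁ hkr₁ r₂ hr₂ hkr₂ g₁ hg₁ g₂ hg₂ g₁' hg₁' g₂' hg₂' k hk₁ hk₂ hO'₁ hO'₂ ψ hψ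
        (restrict r₁ g₁ g₁' (liftSubmonoid_mono r₁ g₁ g₁' k hk₁) x) =
      restrict r₂ g₂ g₂' (liftSubmonoid_mono r₂ g₂ g₂' k hk₂) (ψ x) :=
  gluingRestrictHom_restrict hJ r₁ r₂ hr₂ hkr₂ g₁ hg₁ g₂ hg₂ g₁' g₂' hg₂' k hk₁ hk₂ hO'₂ ψ hψ x

/-- **Intertwining for the inverse:** `ψ′⁻¹ (y|) = (ψ⁻¹ y)|`. [cite: Hartshorne2010, Thm. 10.2 (a) (proof), p. 81] -/
theorem gluingRestrict_symm_restrict (y : CanonicalLift r₂ g₂) :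
    (gluingRestrict hJ r₁ hr₁ hkr₁ r₂ hr₂ hkr₂ g₁ hg₁ g₂ hg₂ g₁' hg₁' g₂' hg₂' k hk₁ hk₂ hO'₁ hO'₂ ψ hψ).symm
        (restrict r₂ g₂ g₂' (liftSubmonoid_mono r₂ g₂ g₂' k hk₂) y) =
      restrict r₁ g₁ g₁' (liftSubmonoid_mono r₁ g₁ g₁' k hk₁) (ψ.symm y) :=
  gluingRestrictHom_restrict hJ r₂ r₁ hr₁ hkr₁ g₂ hg₂ g₁ hg₁ g₂' g₁' hg₁' k hk₂ hk₁ hO'₁ ψ.symm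
    (reduction_symm r₁ r₂ g₁ hg₁ g₂ hg₂ ψ hψ) y

/-- **Reduction-compatibility** of the restricted gluing. [cite: Hartshorne2010, Thm. 10.2 (a) (proof), p. 81] -/
theorem reduction_gluingRestrict (y : CanonicalLift r₁ g₁') :
    reduction r₂ g₂' hg₂' (gluingRestrict hJ r₁ hr₁ hkr₁ r₂ hr₂ hkr₂ g₁ hg₁ g₂ hg₂ g₁' hg₁' g₂' hg₂' k hk₁ hk₂ hO'₁ hO'₂ ψ hψ y) =
      reduction r₁ g₁' hg₁' y :=
  reduction_gluingRestrictHom hJ r₁ r₂ hr₂ hkr₂ g₁ hg₁ g₂ hg₂ g₁' hg₁' g₂' hg₂' k hk₁ hk₂ hO'₂ ψ hψ y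

/-- **Uniqueness:** any algebra ISOMORPHISM (indeed any algebra map, `gluingRestrictHom_unique`) intertwining the restrictions with `ψ` is
`gluingRestrict`. [cite: Hartshorne2010, Thm. 10.2 (a) (proof), p. 81] [cite: StacksProject, Tag 00CP] -/
theorem gluingRestrict_unique (φ : CanonicalLift r₁ g₁' ≃ₐ[A'] CanonicalLift r₂ g₂')
    (hφ : ∀ x, φ (restrict r₁ g₁ g₁' (liftSubmonoid_mono r₁ g₁ g₁' k hk₁) x) =
      restrict r₂ g₂ g₂' (liftSubmonoid_mono r₂ g₂ g₂' k hk₂) (ψ x)) :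
    φ = gluingRestrict hJ r₁ hr₁ hkr₁ r₂ hr₂ hkr₂ g₁ hg₁ g₂ hg₂ g₁' hg₁' g₂' hg₂' k hk₁ hk₂ hO'₁ hO'₂ ψ hψ :=
  AlgEquiv.coe_toAlgHom_injective
    (gluingRestrictHom_unique hJ r₁ r₂ hr₂ hkr₂ g₁ hg₁ g₂ hg₂ g₁' g₂' hg₂' k hk₁ hk₂ hO'₂ ψ hψ (φ : _ →ₐ[A'] _) hφ)

end Equiv

end Gluing

end Literature.AlgebraicGeometry.Deformation.CanonicalLiftQuot

end
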